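import Literature.NumberTheory.Automorphic.AutomorphicRepLieActionGL
import Literature.NumberTheory.Automorphic.AutomorphicRepsGLSatakeFlathProofs
import Literature.NumberTheory.Automorphic.GKModuleTensor
import Literature.NumberTheory.Automorphic.ResGLnArchCoefficientSignTwist
import HarnessLib

/-!
# The `(𝔤, K_∞)`-complex of the SPACE `W` of an automorphic representation of `GL_n(𝔸_K)` with
# coefficients, and the evaluation of `W ⊗ E` at adelic points

Topic `NumberTheory/Automorphic`; namespaces `Literature.NumberTheory.Automorphic.AutomorphicRepData`,
`….CuspidalAutomorphicRepData`, `….GLn`.  Definitions with bodies and theorems (no named fact, no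
`sorry`).

The tree's `(𝔤, K_∞)`-cohomology of an automorphic representation `π = W / W'`
(`AutomorphicRepData.gkCohomologyWith / cohomologyGL`, `CuspidalAutomorphicRepData.cohomologyLamSign`)
is that of the QUOTIENT `W / W'` (`π.kRep`, `π.lieRep`).  The Borel–Wallach dictionary
[cite: BorelWallach2000, VII 2.2–2.5] — a `(𝔤, K_∞)`-cochain `η : ∧^q 𝔤 → C ⊗ E` with values in cusp
FUNCTIONS gives the `E`-valued differential form `E(g) η(g⁻¹ ·)(g, c)` on `G_∞ × G(𝔸_f)` — needs the
complex of the SPACE `W` itself (for clean data `W' = ⊥` the two agree), and the evaluation of an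
element of `W ⊗ E` at an adelic point.  THIS FILE supplies exactly that vocabulary:

* `AutomorphicRepData.kRepW_lieRepW_ad_compat` — the `(𝔤, K)`-compatibility
  `r(k) ∘ X ∘ r(k⁻¹) = Ad(k) X` on `W` (`archTranslate_lieDeriv`);
* `AutomorphicRepData.gkComplexW π σK σ𝔤 hE` — **the `(𝔤, K_∞)`-complex `C^•(𝔤, K_∞; W ⊗ E)`** of
  the pair (`π.kRepW ⊗ σK`, Leibniz action of `π.lieRepW` and `σ𝔤`) for any coefficient
  `(𝔤, K_∞)`-module `E = (σK, σ𝔤)` (`gkComplex`, `GKTensor.lie`, `GKTensor.ad_compat`)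
  [cite: BorelWallach2000, I §5.1 (1)–(3)];
* `CuspidalAutomorphicRepData.gkComplexLamSign π S λ` — the case `E = E_λ(ℂ) ⊗ ε_S`
  (`ResGLnCohomology.archCoeffRepSign / archCoeffLie`) [cite: Clozel1990, Lemme 3.14–3.15]
  [cite: GrobnerRaghuram2014, §6 Rem. 27];
* `AutomorphicRepData.evalTensor π E : W ⊗ E →ₗ[ℂ] (GL_n(𝔸_K) → E)`, `ψ ⊗ e ↦ (x ↦ ψ x • e)`, with
  `evalTensor_tmul`, right translations `evalTensor_rTensor_kRepW / _finiteRepW`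
  (`evalTensor (r(h) ⊗ 1) t x = evalTensor t (x h)`) and `evalTensor_lTensor`
  (`evalTensor (1 ⊗ f) t = f ∘ evalTensor t`) [cite: BorelWallach2000, VII 2.2];
* `GLn.archOfMatrix n K : M_n(K_∞) → G_∞` — the matrix `m` as an element of `G_∞ = GL_n(K_∞)` (junk
  `1` off the invertible matrices), `archOfMatrix_coe`, `coe_archOfMatrix` — so that functions on
  `G_∞` can be differentiated in the matrix coordinates of the ambient real vector space
  `M_n(K_∞)` (as Mathlib does for `Ring.inverse`).

## References

* A. Borel, N. Wallach, *Continuous cohomology, discrete subgroups, and representations of reductive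
  groups*, 2nd ed. (2000), I §5.1, VII 2.2–2.5. [BorelWallach2000]
* A. Borel, H. Jacquet, Corvallis (1979), §1.5, 4.6. [BorelJacquet1979]
* L. Clozel, *Motifs et formes automorphes* (1990), Lemme 3.14–3.15. [Clozel1990]
* H. Grobner, A. Raghuram, Int. J. Number Theory 10 (2014), §6 Rem. 27. [GrobnerRaghuram2014]
-/

noncomputable section

namespace Literature.NumberTheory.Automorphic

open scoped TensorProduct MatrixGroups Classical
open NumberField NumberField.mixedEmbedding RealMatrixGroup

-- Mathlib idiom (as in `GKModules`): commutator bracket on `Module.End` / matrix algebras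
attribute [local instance 100] LieRing.ofAssociativeRing

/-! ### Matrices as elements of `G_∞` -/

namespace GLn

variable (n : ℕ) (K : Type) [Field K] [NumberField K]

/-- **The matrix `m ∈ M_n(K_∞)` as an element of `G_∞ = GL_n(K_∞)`** (`archGroupGL n K`, whose
carrier is all of `GL_n(K_∞)`), with junk value `1` when `m` is not invertible — so that a function
on `G_∞` becomes a function on the real vector space `M_n(K_∞)`, to be differentiated in matrix
coordinates on the open set of invertible matrices. [folklore] -/
def archOfMatrix (m : Matrix (Fin n) (Fin n) (mixedSpace K)) : (archGroupGL n K).carrier :=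
  if h : IsUnit m then ⟨h.unit, Subgroup.mem_top _⟩ else 1

variable {n K}

/-- On an invertible matrix, `archOfMatrix` is that matrix. [folklore] -/
theorem coe_archOfMatrix {m : Matrix (Fin n) (Fin n) (mixedSpace K)} (hm : IsUnit m) :
    (((archOfMatrix n K m : (archGroupGL n K).carrier) : GL (Fin n) (mixedSpace K)) :
      Matrix (Fin n) (Fin n) (mixedSpace K)) = m := by
  rw [archOfMatrix, dif_pos hm]
  exact hm.unit_spec

/-- `archOfMatrix` of (the matrix of) `g ∈ G_∞` is `g`. [folklore] -/
@[simp]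
theorem archOfMatrix_coe (g : (archGroupGL n K).carrier) :
    archOfMatrix n K ((g : GL (Fin n) (mixedSpace K)) : Matrix (Fin n) (Fin n) (mixedSpace K)) = g := by
  have hu : IsUnit (((g : GL (Fin n) (mixedSpace K)) : Matrix (Fin n) (Fin n) (mixedSpace K))) :=
    Units.isUnit _
  refine Subtype.ext (Units.ext ?_)
  rw [coe_archOfMatrix hu]

/-- `archOfMatrix` of a unit, as a unit. [folklore] -/
theorem archOfMatrix_val (u : GL (Fin n) (mixedSpace K)) :
    ((archOfMatrix n K (u : Matrix (Fin n) (Fin n) (mixedSpace K)) : (archGroupGL n K).carrier) :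
      GL (Fin n) (mixedSpace K)) = u :=
  congrArg Subtype.val (archOfMatrix_coe (⟨u, Subgroup.mem_top _⟩ : (archGroupGL n K).carrier))

end GLn

/-! ### The `(𝔤, K_∞)`-complex of `W ⊗ E` -/

namespace AutomorphicRepData

variable {n : ℕ} {K : Type} [Field K] [NumberField K] {hcpt : isCompact_glFiniteIntegralLevel n K}
  (π : AutomorphicRepData (AutomorphyDatum.gl n K hcpt))

/-- **`(𝔤, K)`-compatibility on `W`**: `r(k) ∘ X ∘ r(k⁻¹) = Ad(k) X` for the right translation by
`k ∈ K_∞` (`π.kRepW`) and the Lie derivative along `X ∈ 𝔤` (`π.lieRepW`) — from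
`archTranslate_lieDeriv` (`exp (t · kXk⁻¹) k = k exp (tX)`). [cite: BorelJacquet1979, §1.5] -/
theorem kRepW_lieRepW_ad_compat (k : (AutomorphyDatum.gl n K hcpt).arch.maximalCompact)
    (X : (AutomorphyDatum.gl n K hcpt).arch.lie) :
    π.kRepW k ∘ₗ π.lieRepW X ∘ₗ π.kRepW k⁻¹ =
      π.lieRepW ((AutomorphyDatum.gl n K hcpt).arch.Ad
        (Subgroup.inclusion (AutomorphyDatum.gl n K hcpt).arch.maximalCompact_le_carrier k) X) := by
  refine LinearMap.ext fun φ => Subtype.ext ?_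
  set h : (AutomorphyDatum.gl n K hcpt).arch.carrier :=
    Subgroup.inclusion (AutomorphyDatum.gl n K hcpt).arch.maximalCompact_le_carrier k with hh
  change archTranslate (AutomorphyDatum.gl n K hcpt).ofArch h
      (lieDeriv (AutomorphyDatum.gl n K hcpt).ofArch X
        (archTranslate (AutomorphyDatum.gl n K hcpt).ofArch h⁻¹ (φ : (AdelicGroupData.gl n K).Adelic → ℂ))) =
    lieDeriv (AutomorphyDatum.gl n K hcpt).ofArch ((AutomorphyDatum.gl n K hcpt).arch.Ad h X)
      (φ : (AdelicGroupData.gl n K).Adelic → ℂ)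
  rw [archTranslate_lieDeriv, ← Module.End.mul_apply, ← map_mul, mul_inv_cancel, map_one,
    Module.End.one_apply]

variable {E : Type*} [AddCommGroup E] [Module ℂ E]
  (σK : Representation ℂ (AutomorphyDatum.gl n K hcpt).arch.maximalCompact E)
  (σ𝔤 : (AutomorphyDatum.gl n K hcpt).arch.lie →ₗ⁅ℝ⁆ Module.End ℂ E)
  (hE : ∀ (k : (AutomorphyDatum.gl n K hcpt).arch.maximalCompact) (X : (AutomorphyDatum.gl n K hcpt).arch.lie),
    σK k ∘ₗ σ𝔤 X ∘ₗ σK k⁻¹ =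
      σ𝔤 ((AutomorphyDatum.gl n K hcpt).arch.Ad
        (Subgroup.inclusion (AutomorphyDatum.gl n K hcpt).arch.maximalCompact_le_carrier k) X))

/-- **The `(𝔤, K_∞)`-complex `C^•(𝔤, K_∞; W ⊗ E)` of the SPACE `W`** of an automorphic representation
`π = W / W'` of `GL_n(𝔸_K)` with coefficients in a `(𝔤, K_∞)`-module `E = (σK, σ𝔤)`: cochains
`η : ∧^q 𝔤 →ₗ[ℝ] W ⊗_ℂ E` (`GKCarrier` of the Leibniz action `X ↦ X ⊗ 1 + 1 ⊗ σ𝔤 X`), relative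
for `𝔨` and fixed by `K_∞` acting through `Ad ⊗ (r ⊗ σK)`.  For `W' = ⊥` this is the complex of
`π` itself. [cite: BorelWallach2000, I §5.1 (1)–(3)] -/
abbrev gkComplexW :
    Literature.Algebra.Lie.ChevalleyEilenberg.Subcomplex ℝ (AutomorphyDatum.gl n K hcpt).arch.lie
      (GKCarrier (AutomorphyDatum.gl n K hcpt).arch
        (GKTensor.lie (AutomorphyDatum.gl n K hcpt).arch π.lieRepW σ𝔤)) :=
  gkComplex (AutomorphyDatum.gl n K hcpt).arch (π.kRepW.tprod σK)
    (GKTensor.lie (AutomorphyDatum.gl n K hcpt).arch π.lieRepW σ𝔤)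
    (GKTensor.ad_compat (AutomorphyDatum.gl n K hcpt).arch π.kRepW π.lieRepW σK σ𝔤
      π.kRepW_lieRepW_ad_compat hE)

/-! ### Evaluation of `W ⊗ E` at adelic points -/

variable (E) in
/-- **Evaluation** `W ⊗_ℂ E → (GL_n(𝔸_K) → E)`, `ψ ⊗ e ↦ (x ↦ ψ x • e)` — an element of `W ⊗ E` as an
`E`-valued function on the adelic group. [cite: BorelWallach2000, VII 2.2] -/
def evalTensor : π.W ⊗[ℂ] E →ₗ[ℂ] ((AdelicGroupData.gl n K).Adelic → E) :=
  TensorProduct.lift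
    { toFun := fun ψ =>
        { toFun := fun e x => (ψ : (AdelicGroupData.gl n K).Adelic → ℂ) x • e
          map_add' := fun e e' => funext fun x => smul_add _ _ _
          map_smul' := fun c e => funext fun x => smul_comm _ _ _ }
      map_add' := fun ψ ψ' => LinearMap.ext fun e => funext fun x => by
        change ((ψ : _ → ℂ) x + (ψ' : _ → ℂ) x) • e = (ψ : _ → ℂ) x • e + (ψ' : _ → ℂ) x • e
        rw [add_smul]
      map_smul' := fun c ψ => LinearMap.ext fun e => funext fun x => by
        change (c * (ψ : _ → ℂ) x) • e = c • ((ψ : _ → ℂ) x • e)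
        rw [mul_smul] }

/-- `evalTensor (ψ ⊗ e) x = ψ x • e`. [folklore] -/
@[simp]
theorem evalTensor_tmul (ψ : π.W) (e : E) (x : (AdelicGroupData.gl n K).Adelic) :
    π.evalTensor E (ψ ⊗ₜ e) x = (ψ : (AdelicGroupData.gl n K).Adelic → ℂ) x • e :=
  rfl

/-- **Right `K_∞`-translation upstairs is translation of the argument**:
`evalTensor ((r(k) ⊗ 1) t) x = evalTensor t (x · k)`. [cite: BorelJacquet1979, 4.6] -/
theorem evalTensor_rTensor_kRepW (k : (AutomorphyDatum.gl n K hcpt).arch.maximalCompact) (t : π.W ⊗[ℂ] E)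
    (x : (AdelicGroupData.gl n K).Adelic) :
    π.evalTensor E ((π.kRepW k).rTensor E t) x =
      π.evalTensor E t (x * (AutomorphyDatum.gl n K hcpt).ofK k) := by
  induction t using TensorProduct.induction_on with
  | zero => simp only [map_zero, Pi.zero_apply]
  | tmul ψ e => rfl
  | add t t' ht ht' => simp only [map_add, Pi.add_apply, ht, ht']

/-- **Right `G(𝔸_f)`-translation upstairs is translation of the argument**:
`evalTensor ((r(h) ⊗ 1) t) x = evalTensor t (x · h)`. [cite: BorelJacquet1979, 4.6] -/
theorem evalTensor_rTensor_finiteRepW (h : (AutomorphyDatum.gl n K hcpt).finiteAdelic)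
    (t : π.W ⊗[ℂ] E) (x : (AdelicGroupData.gl n K).Adelic) :
    π.evalTensor E ((π.finiteRepW h).rTensor E t) x =
      π.evalTensor E t (x * (h : (AdelicGroupData.gl n K).Adelic)) := by
  induction t using TensorProduct.induction_on with
  | zero => simp only [map_zero, Pi.zero_apply]
  | tmul ψ e => rfl
  | add t t' ht ht' => simp only [map_add, Pi.add_apply, ht, ht']

/-- **The diagonal `K_∞`-action upstairs**: `evalTensor ((r(k) ⊗ σK k) t) x = σK k (evalTensor t (x · k))`.
[cite: BorelWallach2000, I §5.1] -/
theorem evalTensor_tprod_kRepW (k : (AutomorphyDatum.gl n K hcpt).arch.maximalCompact) (t : π.W ⊗[ℂ] E)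
    (x : (AdelicGroupData.gl n K).Adelic) :
    π.evalTensor E (π.kRepW.tprod σK k t) x =
      σK k (π.evalTensor E t (x * (AutomorphyDatum.gl n K hcpt).ofK k)) := by
  induction t using TensorProduct.induction_on with
  | zero => simp only [map_zero, Pi.zero_apply]
  | tmul ψ e =>
    rw [Representation.tprod_apply, TensorProduct.map_tmul, evalTensor_tmul, evalTensor_tmul,
      map_smul]
    rfl
  | add t t' ht ht' => simp only [map_add, Pi.add_apply, ht, ht']

/-- **A linear map on the coefficients acts on the values**:
`evalTensor ((1 ⊗ f) t) x = f (evalTensor t x)`. [folklore] -/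
theorem evalTensor_lTensor {E' : Type*} [AddCommGroup E'] [Module ℂ E'] (f : E →ₗ[ℂ] E')
    (t : π.W ⊗[ℂ] E) (x : (AdelicGroupData.gl n K).Adelic) :
    π.evalTensor E' (f.lTensor π.W t) x = f (π.evalTensor E t x) := by
  induction t using TensorProduct.induction_on with
  | zero => simp only [map_zero, Pi.zero_apply]
  | tmul ψ e => rw [LinearMap.lTensor_tmul, evalTensor_tmul, evalTensor_tmul, map_smul]
  | add t t' ht ht' => simp only [map_add, Pi.add_apply, ht, ht']

/-- The coordinates `y ↦ ℓ (evalTensor t y)` of an evaluated tensor are smooth in the archimedean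
variable (finite sums of elements of `W ≤ 𝒜`). [cite: BorelJacquet1979, 4.2(b)] -/
theorem isArchSmooth_apply_evalTensor (t : π.W ⊗[ℂ] E) (ℓ : E →ₗ[ℂ] ℂ) :
    IsArchSmooth (AutomorphyDatum.gl n K hcpt).ofArch fun y => ℓ (π.evalTensor E t y) := by
  induction t using TensorProduct.induction_on with
  | zero =>
    simp only [map_zero, Pi.zero_apply]
    exact (archSmooth (AutomorphyDatum.gl n K hcpt).ofArch).zero_mem
  | tmul ψ e =>
    have hfun : (fun y => ℓ (π.evalTensor E (ψ ⊗ₜ[ℂ] e) y)) =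
        (ℓ e) • (ψ : (AdelicGroupData.gl n K).Adelic → ℂ) := by
      funext y
      rw [evalTensor_tmul, map_smul, smul_eq_mul, Pi.smul_apply, smul_eq_mul, mul_comm]
    rw [hfun]
    exact (π.isArchSmooth_of_mem_W ψ.2).smul _ (ℓ e)
  | add t t' ht ht' =>
    have hfun : (fun y => ℓ (π.evalTensor E (t + t') y)) =
        (fun y => ℓ (π.evalTensor E t y)) + fun y => ℓ (π.evalTensor E t' y) := by
      funext y
      simp only [map_add, Pi.add_apply]
    rw [hfun]
    exact ht.add _ ht'

/-- **The Lie derivative upstairs is the Lie derivative of the values**: for every linear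
functional `ℓ` on `E`, `ℓ ∘ evalTensor ((X ⊗ 1) t) = X (ℓ ∘ evalTensor t)`.
[cite: BorelJacquet1979, §1.5] -/
theorem apply_evalTensor_rTensor_lieRepW (X : (AutomorphyDatum.gl n K hcpt).arch.lie) (t : π.W ⊗[ℂ] E)
    (ℓ : E →ₗ[ℂ] ℂ) (x : (AdelicGroupData.gl n K).Adelic) :
    ℓ (π.evalTensor E ((π.lieRepW X).rTensor E t) x) =
      lieDeriv (AutomorphyDatum.gl n K hcpt).ofArch X (fun y => ℓ (π.evalTensor E t y)) x := by
  induction t using TensorProduct.induction_on with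
  | zero =>
    simp only [map_zero, Pi.zero_apply]
    rw [show (fun _ : (AdelicGroupData.gl n K).Adelic => (0 : ℂ)) = 0 from rfl, lieDeriv_zero_right,
      Pi.zero_apply]
  | tmul ψ e =>
    have hfun : (fun y => ℓ (π.evalTensor E (ψ ⊗ₜ[ℂ] e) y)) =
        (ℓ e) • (ψ : (AdelicGroupData.gl n K).Adelic → ℂ) := by
      funext y
      rw [evalTensor_tmul, map_smul, smul_eq_mul, Pi.smul_apply, smul_eq_mul, mul_comm]
    rw [hfun, lieDeriv_smul, LinearMap.rTensor_tmul, evalTensor_tmul, map_smul, smul_eq_mul,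
      Pi.smul_apply, smul_eq_mul, mul_comm]
    rfl
  | add t t' ht ht' =>
    have hfun : (fun y => ℓ (π.evalTensor E (t + t') y)) =
        (fun y => ℓ (π.evalTensor E t y)) + fun y => ℓ (π.evalTensor E t' y) := by
      funext y
      simp only [map_add, Pi.add_apply]
    rw [map_add, map_add, Pi.add_apply, map_add, ht, ht', hfun,
      IsArchSmooth.lieDeriv_add _ X (π.isArchSmooth_apply_evalTensor t ℓ)
        (π.isArchSmooth_apply_evalTensor t' ℓ), Pi.add_apply]

end AutomorphicRepData

/-! ### The case `E = E_λ(ℂ) ⊗ ε_S` -/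

namespace CuspidalAutomorphicRepData

open ResGLnCohomology

variable {n : ℕ} {K : Type} [Field K] [NumberField K] {hcpt : isCompact_glFiniteIntegralLevel n K}
  (π : CuspidalAutomorphicRepData n K hcpt) (S : Finset {w : NumberField.InfinitePlace K // w.IsReal})
  (lam : (K →+* ℂ) → Fin n → ℤ)

set_option maxHeartbeats 800000 in
-- the statement elaborates through the `restrictK` / `archCoeffRepSign` abbrev towers
/-- **`C^•(𝔤, K_∞; C ⊗ (E_λ(ℂ) ⊗ ε_S))`** for the space `C = π.W` of a cuspidal `π` of `GL_n(𝔸_K)`, a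
weight family `λ` and a set `S` of real places (coefficients `ResGLnCohomology.archCoeffRepSign n K S λ`
restricted to `K_∞`, Leibniz differential `archCoeffLie n K λ`).
[cite: Clozel1990, Lemme 3.14–3.15] [cite: GrobnerRaghuram2014, §6 Rem. 27] -/
abbrev gkComplexLamSign :
    Literature.Algebra.Lie.ChevalleyEilenberg.Subcomplex ℝ (AutomorphyDatum.gl n K hcpt).arch.lie
      (GKCarrier (AutomorphyDatum.gl n K hcpt).arch
        (GKTensor.lie (AutomorphyDatum.gl n K hcpt).arch π.1.lieRepW (archCoeffLie n K lam))) :=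
  π.1.gkComplexW (restrictK (archGroupGL n K) (archCoeffRepSign n K S lam)) (archCoeffLie n K lam)
    (isGKModule_archCoeffSign n K S lam).ad_compat

end CuspidalAutomorphicRepData

end Literature.NumberTheory.Automorphic

end
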